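import Summits.Ventures.HSemireg.WedgeApolarSpikes

/-!
# Venture HSemireg — THE APOLAR PAIRING IN CLOSED FORM: `apolar_m(q, q′) = (−1)^{m(m−1)/2} · Σ_{p=0}^{m} (−1)^p C(m,p) q_p q′_{m−p}` as ONE `Finset.sum` identity (the classical apolar invariant of
# two binary forms of degree `m`, in th-7's sequence vocabulary), and its diagonal `apolar_m(q, q)` (the quadratic invariant: `m = 2` the discriminant, `m = 4` the invariant `i`)

HONEST FRAMING. Part of the Lean index of the computation cell `pub-hsemireg` (seat p10 gen 19, Sunday typer «UNIFORM-IN-n»).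
ALGEBRA of th-7's coefficient sequences ONLY: no variety, no cohomology theory, no sheaf, no Ext group, no semiregularity map;
nothing here says that HC / HC_CM / HC_AV holds; no Literature fact is declared or used.  Custodian versions as in `WedgeHankelSiegelIdeal` (1/3); the dictionary (apolarity / the
transvectant `(f, g)_m` of binary forms) is QUOTED, never asserted.

WHAT IS IN THE TREE.  I14 `WedgeApolarPairing` (964): `apolar` by th-7's recursion, `apolar_swap`, **`w_mul_w`** (`w_m(q) ∧ w_m(q′) = apolar_m(q,q′)·Π`), `apolar_sbSeq`; I15 `WedgeApolarSpikes`
(972): `apolar_spike_spike`, **`apolar_eq_sum_spike_left`** (`apolar m q q′ = Σ_{p ≤ m} q_p·apolar m δ_p q′`), **`apolar_spike_right`**.  I14/I15 left the one-sum closed form as NOT typed.  THIS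
FILE types it (namespace `Summit.Ventures.HSemireg.Wedge.KernelDuality` continued):
* §208 `neg_one_pow_mul_neg_one_pow_sub` (`(−1)^m (−1)^{m−p} = (−1)^p`, `p ≤ m`), **`apolar_spike_left`: `apolar m δ_p q′ = (−1)^{m(m−1)/2} (−1)^p C(m,p) q′_{m−p}`** (`p ≤ m`; from I15's
  right version by `apolar_swap` and `C(m, m−p) = C(m, p)`), `apolar_spike_left_of_lt` (`= 0` for `p > m`).
* §209 **`apolar_eq_sum`: `apolar m q q′ = (−1)^{m(m−1)/2} · Σ_{p ∈ range (m+1)} (−1)^p · C(m,p) · q_p · q′_{m−p}`** and **`apolar_self_eq_sum`** (the diagonal); `apolar_two_self`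
  (`= −2(q₀q₂ − q₁²)`), `apolar_four_self` (`= 2(q₀q₄ − 4q₁q₃ + 3q₂²)`, the invariant `i` of binary quartics — dictionary quoted).
NOT typed here: the cubic / higher invariants (they are not bilinear in the class); anything Ext-side.  New names only.
-/

open Module

namespace Summit.Ventures.HSemireg.Wedge.KernelDuality

open Summit.Ventures.HSemireg.Wedge Summit.Ventures.HSemireg.Wedge.Kunneth Summit.Ventures.HSemireg.Wedge.Hankel
  Summit.Ventures.HSemireg.Wedge.KunnethKernel Summit.Ventures.HSemireg.Wedge.HankelFrameChange

variable (K : Type*) [Field K]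

/-! ## §208. The pairing against a spike on the left -/

omit [Field K] in
/-- `(−1)^m · (−1)^{m−p} = (−1)^p` for `p ≤ m` (in any ring). -/
private lemma neg_one_pow_mul_neg_one_pow_sub {R : Type*} [CommRing R] {m p : ℕ} (hp : p ≤ m) : (-1 : R) ^ m * (-1) ^ (m - p) = (-1) ^ p := by
  have h : (-1 : R) ^ m = (-1) ^ (m - p) * (-1) ^ p := by rw [← pow_add, Nat.sub_add_cancel hp]
  rw [h, mul_comm ((-1 : R) ^ (m - p)), mul_assoc, ← pow_add, ← two_mul, pow_mul, neg_one_sq, one_pow, mul_one]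

/-- **`apolar m δ_p q′ = (−1)^{m(m−1)/2} · (−1)^p · C(m,p) · q′_{m−p}`** for `p ≤ m` (I15's `apolar_spike_right` through `apolar_swap`). -/
theorem apolar_spike_left (m : ℕ) {p : ℕ} (hp : p ≤ m) (q' : ℕ → K) :
    apolar K m (fun j => if j = p then (1 : K) else 0) q' = (-1) ^ (m * (m - 1) / 2) * (-1) ^ p * (m.choose p : K) * q' (m - p) := by
  have h := apolar_swap K m q' (fun j => if j = p then (1 : K) else 0)
  rw [apolar_spike_right K m q' hp, Nat.choose_symm hp] at h
  rw [h, ← neg_one_pow_mul_neg_one_pow_sub (R := K) hp]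
  ring

/-- beyond the window the spike pairs to zero: `apolar m δ_p q′ = 0` for `m < p`. -/
theorem apolar_spike_left_of_lt {m p : ℕ} (hp : m < p) (q' : ℕ → K) : apolar K m (fun j => if j = p then (1 : K) else 0) q' = 0 := by
  rw [apolar_congr K m (q₁ := fun j => if j = p then (1 : K) else 0) (q₂ := fun _ => 0) (q₁' := q') (q₂' := q') (fun j hj => if_neg (by omega)) (fun _ _ => rfl)]
  exact apolar_zero_seq_left K m q'

/-! ## §209. The closed form -/

/-- **THE APOLAR PAIRING IN CLOSED FORM: `apolar m q q′ = (−1)^{m(m−1)/2} · Σ_{p=0}^{m} (−1)^p · C(m,p) · q_p · q′_{m−p}`** (dictionary: the `m`-th transvectant / apolar invariant of the two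
binary forms with moments `q`, `q′`). -/
theorem apolar_eq_sum (m : ℕ) (q q' : ℕ → K) :
    apolar K m q q' = (-1) ^ (m * (m - 1) / 2) * ∑ p ∈ Finset.range (m + 1), (-1) ^ p * (m.choose p : K) * q p * q' (m - p) := by
  rw [apolar_eq_sum_spike_left, Finset.mul_sum]
  refine Finset.sum_congr rfl fun p hp => ?_
  rw [apolar_spike_left K m (Nat.lt_succ_iff.mp (Finset.mem_range.mp hp)) q']
  ring

/-- **the diagonal: `apolar m q q = (−1)^{m(m−1)/2} · Σ_p (−1)^p C(m,p) q_p q_{m−p}`** — the quadratic invariant carried by `w_m(q) ∧ w_m(q)` (I14 `w_mul_self`). -/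
theorem apolar_self_eq_sum (m : ℕ) (q : ℕ → K) :
    apolar K m q q = (-1) ^ (m * (m - 1) / 2) * ∑ p ∈ Finset.range (m + 1), (-1) ^ p * (m.choose p : K) * q p * q (m - p) :=
  apolar_eq_sum K m q q

/-- `m = 2`: `apolar 2 q q = −2(q₀q₂ − q₁²)` (the DISCRIMINANT of the binary quadratic, up to the factor `−2`). -/
theorem apolar_two_self (q : ℕ → K) : apolar K 2 q q = -2 * (q 0 * q 2 - q 1 ^ 2) := by
  rw [apolar_two]; ring

/-- `m = 4`: `apolar 4 q q = 2(q₀q₄ − 4q₁q₃ + 3q₂²)` (the INVARIANT `i` of the binary quartic, up to the factor `2`; dictionary quoted). -/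
theorem apolar_four_self (q : ℕ → K) : apolar K 4 q q = 2 * (q 0 * q 4 - 4 * (q 1 * q 3) + 3 * q 2 ^ 2) := by
  rw [apolar_self_eq_sum]
  simp only [Finset.sum_range_succ, Finset.sum_range_zero, Nat.choose, show (4 : ℕ) * (4 - 1) / 2 = 6 by norm_num]
  norm_num
  ring

end Summit.Ventures.HSemireg.Wedge.KernelDuality
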